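import Summits.FinalStateConjecture.FinalStateConjecture.Theorems.ClusterCompletenessAdiabaticMultiKerrILEDLateTransport
import Literature.Geometry.Lorentzian.KerrSchildWaveCauchyProblem
import HarnessLib

/-!
# Route ClusterCompleteness — crux `AdiabaticMultiKerrILED`, line `Sketch`: the red-shift estimate of
# one boosted hole between LAB slices (helpers for `stub_lateAssembly`)

Helper file for the crux `stmt-FinalStateConjecture-14310`
(`Summit.FinalStateConjecture.FinalStateConjecture.Theses.ClusterCompleteness.AdiabaticMultiKerrILED`),
line `Sketch`, serving the lead's assembly stub `stub_lateAssembly`.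

For a hole in inertial motion (`q = Λ⁻¹(· − (0,p))` its rest-frame map, `u⁰` its lab Lorentz factor,
lab slices `{x⁰ = t}` = rest-frame graph leaves `{z⁰ = t/u⁰ + F(z⃗)}` with `F` linear of slope
`≤ 1/2`), the rest-frame red-shift estimate between graph leaves — assumed in the LOCAL form of
`stub_redShiftLocal` (wave equation only on the collar `{r ≤ r₊ + η}` in the future of the initial
leaf) — gives, for every rest-frame function `Φ` solving the exact Kerr equation at the zone points
whose lab image has `x⁰ ≥ 0` (`stub_zonePullbackWave`), the LAB-TIME inequality between lab slices
`s₁ ≤ s₂`, `s₁ ≥ 0`: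
`A_{η/2}(s₂) + (1/u⁰) ∫_{s₁}^{s₂} A_{η/2} ≤ 2C (A_η(s₁) + (1/u⁰) ∫_{s₁}^{s₂} A_shell)`
for the lab-slice integrals `A_S(τ) = ∫ (1_S · Σ_μ (∂_μΦ)²)(q(τ, y)) dy` of the rest-frame coordinate
energy density on the collars `S` (`collar_redshift_lab`); `collar_wave_local` checks the local wave
hypothesis (a collar point in the future of the leaf of lab time `s₁ ≥ 0` has lab time `≥ 0` and
`r < 8M`). Dafermos–Rodnianski arXiv:0811.0354, §3.3.3–§3.3.4; O'Neill 1983, Ch. 9. [folklore]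
-/

noncomputable section

-- the doubled `FinalStateConjecture.FinalStateConjecture` path component trips dupNamespace
set_option linter.dupNamespace false

open scoped ENNReal BigOperators ContDiff
open Set MeasureTheory Literature.Geometry.Lorentzian

namespace Summit.FinalStateConjecture.FinalStateConjecture.Cruxes.AdiabaticMultiKerrILED.Sketch

/-- `r₊ ≤ 2M` for `M ≥ 0` (`r₊ = M + √(M² − a²)`). [folklore] -/
private theorem lrs_rPlus_le_two_mul {M : ℝ} (hM : 0 ≤ M) (a : ℝ) : Kerr.rPlus M a ≤ 2 * M := by
  unfold Kerr.rPlus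
  have : Real.sqrt (M ^ 2 - a ^ 2) ≤ M := by
    calc Real.sqrt (M ^ 2 - a ^ 2) ≤ Real.sqrt (M ^ 2) :=
          Real.sqrt_le_sqrt (sub_le_self _ (sq_nonneg a))
      _ = M := Real.sqrt_sq hM
  linarith

/-- **The local wave hypothesis of the red-shift estimate holds for the pulled-back solution.** If
`Φ` solves the exact Kerr equation at every rest-frame point `z` with `r₊ < r(z) < 8M` whose lab image
`Λ z + (0, p)` has nonnegative lab time, then it solves it at every exterior point of the collar
`{r ≤ r₊ + η}` (`η ≤ M`) lying in the future of the leaf `{z⁰ = s₁/u⁰ + F(z⃗)}` of a lab time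
`s₁ ≥ 0` — because that leaf condition says exactly that the lab time is `≥ s₁`
(`(q x)⁰ = x⁰/u⁰ + F((q x)⃗)`). O'Neill 1983, Ch. 9 (Poincaré maps). [folklore] -/
theorem collar_wave_local {Λ : lorentzGroup} {p : E3} {u : E4} {q : E4 → E4}
    (hq : ∀ x, q x = poincareInv Λ (E4.ofTimeSpace 0 p) x) (hu0 : 0 < u 0) {F : E3 → ℝ}
    (hSL1 : ∀ x : E4, q x 0 = (u 0)⁻¹ * x 0 + F (E4.spatial (q x)))
    {M a η : ℝ} (hM : 0 < M) (hηM : η ≤ M) {Φ : E4 → ℝ}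
    (HPB : ∀ z : E4, 0 ≤ ((Λ : E4 ≃L[ℝ] E4) z + E4.ofTimeSpace 0 p) 0 →
      Kerr.rPlus M a < Kerr.radius a z → Kerr.radius a z < 8 * M →
      KerrSchild.waveOperator
        (KerrSchild.inverseMetric (fun y ↦ 2 * Kerr.scalarH M a y) (Kerr.nullVector a)) Φ z = 0)
    {s₁ : ℝ} (hs₁ : 0 ≤ s₁) :
    ∀ x ∈ (Kerr.exterior M a : Set E4), Kerr.radius a x ≤ Kerr.rPlus M a + η →
      (u 0)⁻¹ * s₁ + F (E4.spatial x) ≤ x 0 →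
      KerrSchild.waveOperator
        (KerrSchild.inverseMetric (fun y ↦ 2 * Kerr.scalarH M a y) (Kerr.nullVector a)) Φ x = 0 := by
  intro x hx hr hFx
  have hrp : Kerr.rPlus M a < Kerr.radius a x := (le_max_left _ _).trans_lt (Kerr.mem_exterior.1 hx)
  have hr8 : Kerr.radius a x < 8 * M := by
    have := lrs_rPlus_le_two_mul hM.le a
    linarith
  refine HPB x ?_ hrp hr8
  -- the lab image `X = Λ x + (0, p)` has `q X = x`, so `x⁰ = X⁰/u⁰ + F(x⃗)` and `X⁰ ≥ s₁ ≥ 0`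
  set X : E4 := (Λ : E4 ≃L[ℝ] E4) x + E4.ofTimeSpace 0 p with hX
  have hqX : q X = x := by
    rw [hq, poincareInv, hX, add_sub_cancel_right, ContinuousLinearEquiv.symm_apply_apply]
  have h1 := hSL1 X
  rw [hqX] at h1
  have hu0' : (u 0)⁻¹ * X 0 = x 0 - F (E4.spatial x) := by linarith
  have h2 : (u 0)⁻¹ * s₁ ≤ (u 0)⁻¹ * X 0 := by rw [hu0']; linarith
  have h3 : s₁ ≤ X 0 := le_of_mul_le_mul_left h2 (inv_pos.mpr hu0)
  linarith

/-- **The red-shift estimate of one boosted hole between lab slices.** Data: the rest-frame map `q`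
of a hole (`q = poincareInv Λ (0,p)`, lab Lorentz factor `u⁰ > 0`), its slice/leaf correspondence
(`(q x)⁰ = x⁰/u⁰ + F((q x)⃗)` with `F` smooth of slope `≤ 1/2`, the change-of-variables identities
with Jacobian `J` and time factor `u⁰`), the LOCAL red-shift estimate of the exact Kerr metric
`g_{M,a}` at collar parameter `0 < η ≤ M` with constant `C`, and a function `Φ` of class `C²` on the
rest frame solving the Kerr equation at the zone points `r₊ < r < 8M` with lab time `≥ 0`. Then for
lab times `0 ≤ s₁ ≤ s₂`, with `e = Σ_μ (∂_μΦ)²` and `A_S(τ) = ∫ (1_S e)(q(τ, y)) dy`,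
`A_{(r₊, r₊+η/2]}(s₂) + (1/u⁰)∫_{s₁}^{s₂} A_{(r₊, r₊+η/2]} ≤ (C / ½)(A_{(r₊, r₊+η]}(s₁) + (1/u⁰)∫_{s₁}^{s₂} A_{[r₊+η/2, r₊+η]})`
— the red-shift estimate applied along the leaves of the height `s₁/u⁰ + F` (slope `≤ 1/2`, so
`c = 1/2`) and transported to lab variables by `redshift_leaf_to_lab`.
Dafermos–Rodnianski arXiv:0811.0354, §3.3.3; DRSR arXiv:1402.7034, Prop. 4.5.2. [folklore] -/
theorem collar_redshift_lab {Λ : lorentzGroup} {p : E3} {u : E4} {q : E4 → E4}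
    (hq : ∀ x, q x = poincareInv Λ (E4.ofTimeSpace 0 p) x) (hu0 : 0 < u 0)
    {F : E3 → ℝ} {J : ℝ} (hF : ContDiff ℝ ∞ F) (hFslope : ∀ y, ‖fderiv ℝ F y‖ ≤ 2⁻¹)
    (hSL1 : ∀ x : E4, q x 0 = (u 0)⁻¹ * x 0 + F (E4.spatial (q x)))
    (hSL2 : ∀ (g : E4 → ℝ≥0∞) (t : ℝ), ∫⁻ y : E3, g (q (E4.ofTimeSpace t y)) =
      ENNReal.ofReal J * ∫⁻ y' : E3, g (E4.ofTimeSpace ((u 0)⁻¹ * t + F y') y'))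
    (hSL3 : ∀ (f : ℝ → ℝ≥0∞) (t₁ t₂ : ℝ), t₁ ≤ t₂ →
      ∫⁻ t in Set.Ioc t₁ t₂, f ((u 0)⁻¹ * (t - t₁)) =
        ENNReal.ofReal (u 0) * ∫⁻ s in Set.Ioc 0 ((u 0)⁻¹ * (t₂ - t₁)), f s)
    {M a η C : ℝ} (hM : 0 < M) (hηM : η ≤ M)
    (HRS : ∀ (F : E3 → ℝ) (c : ℝ), ContDiff ℝ 2 F → 0 < c → c ≤ 1 →
      (∀ y, ‖fderiv ℝ F y‖ ≤ 1 - c) →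
      ∀ Φ : E4 → ℝ,
      (∀ x ∈ (Kerr.exterior M a : Set E4), ContDiffAt ℝ 2 Φ x) →
      (∀ x ∈ (Kerr.exterior M a : Set E4), Kerr.radius a x ≤ Kerr.rPlus M a + η →
        F (E4.spatial x) ≤ x 0 →
        KerrSchild.waveOperator
          (KerrSchild.inverseMetric (fun y ↦ 2 * Kerr.scalarH M a y) (Kerr.nullVector a)) Φ x = 0) →
      ∀ s : ℝ, 0 ≤ s →
        (∫⁻ y, {y : E3 | Kerr.rPlus M a < Kerr.radius a (E4.ofTimeSpace (s + F y) y) ∧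
              Kerr.radius a (E4.ofTimeSpace (s + F y) y) ≤ Kerr.rPlus M a + η / 2}.indicator
            (fun y ↦ ENNReal.ofReal
              (∑ μ, fderiv ℝ Φ (E4.ofTimeSpace (s + F y) y) (E4.basisVector μ) ^ 2)) y) +
          ∫⁻ u in Set.Ioc 0 s, ∫⁻ y,
            {y : E3 | Kerr.rPlus M a < Kerr.radius a (E4.ofTimeSpace (u + F y) y) ∧
              Kerr.radius a (E4.ofTimeSpace (u + F y) y) ≤ Kerr.rPlus M a + η / 2}.indicator
            (fun y ↦ ENNReal.ofReal
              (∑ μ, fderiv ℝ Φ (E4.ofTimeSpace (u + F y) y) (E4.basisVector μ) ^ 2)) y ≤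
        ENNReal.ofReal (C / c) *
          ((∫⁻ y, {y : E3 | Kerr.rPlus M a < Kerr.radius a (E4.ofTimeSpace (0 + F y) y) ∧
                Kerr.radius a (E4.ofTimeSpace (0 + F y) y) ≤ Kerr.rPlus M a + η}.indicator
              (fun y ↦ ENNReal.ofReal
                (∑ μ, fderiv ℝ Φ (E4.ofTimeSpace (0 + F y) y) (E4.basisVector μ) ^ 2)) y) +
            ∫⁻ u in Set.Ioc 0 s, ∫⁻ y,
              {y : E3 | Kerr.rPlus M a + η / 2 ≤ Kerr.radius a (E4.ofTimeSpace (u + F y) y) ∧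
                Kerr.radius a (E4.ofTimeSpace (u + F y) y) ≤ Kerr.rPlus M a + η}.indicator
              (fun y ↦ ENNReal.ofReal
                (∑ μ, fderiv ℝ Φ (E4.ofTimeSpace (u + F y) y) (E4.basisVector μ) ^ 2)) y))
    {Φ : E4 → ℝ} (hΦ : ContDiff ℝ 2 Φ)
    (HPB : ∀ z : E4, 0 ≤ ((Λ : E4 ≃L[ℝ] E4) z + E4.ofTimeSpace 0 p) 0 →
      Kerr.rPlus M a < Kerr.radius a z → Kerr.radius a z < 8 * M →
      KerrSchild.waveOperator
        (KerrSchild.inverseMetric (fun y ↦ 2 * Kerr.scalarH M a y) (Kerr.nullVector a)) Φ z = 0)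
    {s₁ s₂ : ℝ} (hs₁ : 0 ≤ s₁) (hs : s₁ ≤ s₂) :
    (∫⁻ y : E3, {z : E4 | Kerr.rPlus M a < Kerr.radius a z ∧
          Kerr.radius a z ≤ Kerr.rPlus M a + η / 2}.indicator
        (fun z ↦ ENNReal.ofReal (∑ μ, fderiv ℝ Φ z (E4.basisVector μ) ^ 2))
        (q (E4.ofTimeSpace s₂ y))) +
        ENNReal.ofReal (u 0)⁻¹ * ∫⁻ τ in Set.Ioc s₁ s₂, ∫⁻ y : E3,
          {z : E4 | Kerr.rPlus M a < Kerr.radius a z ∧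
              Kerr.radius a z ≤ Kerr.rPlus M a + η / 2}.indicator
            (fun z ↦ ENNReal.ofReal (∑ μ, fderiv ℝ Φ z (E4.basisVector μ) ^ 2))
            (q (E4.ofTimeSpace τ y)) ≤
      ENNReal.ofReal (C / 2⁻¹) *
        ((∫⁻ y : E3, {z : E4 | Kerr.rPlus M a < Kerr.radius a z ∧
              Kerr.radius a z ≤ Kerr.rPlus M a + η}.indicator
            (fun z ↦ ENNReal.ofReal (∑ μ, fderiv ℝ Φ z (E4.basisVector μ) ^ 2))
            (q (E4.ofTimeSpace s₁ y))) +
          ENNReal.ofReal (u 0)⁻¹ * ∫⁻ τ in Set.Ioc s₁ s₂, ∫⁻ y : E3,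
            {z : E4 | Kerr.rPlus M a + η / 2 ≤ Kerr.radius a z ∧
                Kerr.radius a z ≤ Kerr.rPlus M a + η}.indicator
              (fun z ↦ ENNReal.ofReal (∑ μ, fderiv ℝ Φ z (E4.basisVector μ) ^ 2))
              (q (E4.ofTimeSpace τ y))) := by
  refine redshift_leaf_to_lab hu0 hSL2 hSL3
    (fun z ↦ Kerr.rPlus M a < Kerr.radius a z ∧ Kerr.radius a z ≤ Kerr.rPlus M a + η / 2)
    (fun z ↦ Kerr.rPlus M a < Kerr.radius a z ∧ Kerr.radius a z ≤ Kerr.rPlus M a + η)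
    (fun z ↦ Kerr.rPlus M a + η / 2 ≤ Kerr.radius a z ∧ Kerr.radius a z ≤ Kerr.rPlus M a + η)
    (fun z ↦ ENNReal.ofReal (∑ μ, fderiv ℝ Φ z (E4.basisVector μ) ^ 2))
    (ENNReal.ofReal (C / 2⁻¹)) hs fun s hs0 ↦ ?_
  -- the height `Fₐ = s₁/u⁰ + F`: smooth, slope ≤ 1/2 = 1 − 1/2
  have hFa : ContDiff ℝ 2 fun y : E3 ↦ (u 0)⁻¹ * s₁ + F y :=
    contDiff_const.add (by have := contDiff_infty.1 hF 2; exact_mod_cast this)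
  have hFa_slope : ∀ y, ‖fderiv ℝ (fun y : E3 ↦ (u 0)⁻¹ * s₁ + F y) y‖ ≤ 1 - 2⁻¹ := by
    intro y
    rw [fderiv_const_add]
    exact (hFslope y).trans (by norm_num)
  exact HRS (fun y ↦ (u 0)⁻¹ * s₁ + F y) 2⁻¹ hFa (by norm_num) (by norm_num) hFa_slope Φ
    (fun x _ ↦ hΦ.contDiffAt) (collar_wave_local hq hu0 hSL1 hM hηM HPB hs₁) s hs0

end Summit.FinalStateConjecture.FinalStateConjecture.Cruxes.AdiabaticMultiKerrILED.Sketch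

end
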